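import Summits.ResolutionOfSingularities.ResolutionOfSingularities.Theorems.DeltaCutLaw
import HarnessLib

/-!
# DeltaCutLawB — decomp-res node «DeltaCut» (lens-6 g23, critic row 181 CLEARED DECIDED +1 · MAP +1 (lane (b))),
tree file 2/8 of the node

Content VERBATIM from the decomp-res lens-6 g23 node `HOME/decomp-res-lens-6/g23/DeltaCut.lean` (pin a85f83d5) /
`DeltaCutJ.lean` (9b3a0295); imports the
landed tree only, carries nothing; HOME = run/shared/lean/pub/decomp-res; critic row 181 CLEARED DECIDED +1 · MAP +1
(lane (b)); landing orders NODE-g23.md §10 /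
INBOX :883 — provenance, critic text and the lens header in full in the first file of the node, `DeltaCutLaw`.
Namespace `…Theorems.DeltaCutClasses`;
`--supports stmt-ResolutionOfSingularities-26971`; cone-free.

## This file

Continuation 2/2 of `DeltaCutLaw` (same sections of the node, cut at the 400-line cap): carries `lifting_up`,
`transform_mem_pow_of_delta_heavy`, `delta_law_at`, `transform_mem_pow_iff_delta_heavy`.

[WRITER NOTE (decomp-res writer g11): file split only (tree files ≤ 400 lines); `noncomputable section`, universe,
namespace, sections, section
variables, the `open` lines and every declaration exactly as in the lens; no instance, no notation, no include/omit added.]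

(Sources: Hironaka1967 (characteristic polyhedra); CossartJannsenSaito2020 Def. 3.13 / Thm. 3.14 p. 129, Ch. 8 pp.
128–135, Thm. 9.6 p. 136; Hironaka1970 (near points / vertices); CossartPiltant2008 §2; Giraud1975; EGAIV4 §16–§17
(formal smoothness); StacksProject 0804 / 0BIQ / 031I; Matsumura1987 §28.)
-/

noncomputable section

open CategoryTheory CategoryTheory.Limits AlgebraicGeometry TopologicalSpace IsLocalRing
open Literature.AlgebraicGeometry.Resolution
universe u

open Summit.ResolutionOfSingularities.ResolutionOfSingularities.Theorems.TwistCutClasses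
open Summit.ResolutionOfSingularities.ResolutionOfSingularities.Theorems.LightCutClasses

namespace Summit.ResolutionOfSingularities.ResolutionOfSingularities.Theorems.DeltaCutClasses

section Below

variable {R : Type*} [CommRing R] [IsLocalRing R] {d : ℕ} (c : Fin d → R) (i : Fin d)
  (hc : Ideal.span (Set.range c) = maximalIdeal R) (hqr : IsQuasiRegular c)
variable (𝔴 : Ideal (chartRing c i))

/-- (b) LIFTING UP along an adapted section (LEMMA A + LEMMA B): `s' ∉ 𝔮`, `s'·Ḡ ∈ 𝔮^m`, `m ≤ n`, coefficients adapted to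
`s̄ : κ → R/𝔪^n` ⟹ `χ(G) ∈ 𝔫_L^m` — GENUINELY upstairs. [new] [folklore] -/
theorem lifting_up [𝔴.IsPrime] (hK𝔴 : chartBase c i (c i) ∈ 𝔴)
    {L : Type*} [CommRing L] [IsLocalRing L] (χ : chartRing c i →+* L)
    (hloc : @IsLocalization.AtPrime _ _ L _ χ.toAlgebra 𝔴 _)
    {n : ℕ} (hn : 1 ≤ n) (sbar : ResidueField R →+* R ⧸ (maximalIdeal R) ^ n)
    (hsbar : ∀ β : ResidueField R, ∃ r : R, Ideal.Quotient.mk ((maximalIdeal R) ^ n) r = sbar β ∧ residue R r = β)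
    (E : Finset (Fin d → ℕ)) (b : (Fin d → ℕ) → R)
    (hb : ∀ e ∈ E, Ideal.Quotient.mk ((maximalIdeal R) ^ n) (b e) = sbar (residue R (b e)))
    {m : ℕ} (hmn : m ≤ n) {s' : MvPolynomial {j : Fin d // j ≠ i} (ResidueField R)}
    (hs' : s' ∉ 𝔴.map (rho c i hc hqr))
    (hs'G : s' * (∑ e ∈ E, MvPolynomial.monomial (restrictExp i e) (residue R (b e))) ∈ (𝔴.map (rho c i hc hqr)) ^ m) :
    χ (∑ e ∈ E, chartBase c i (b e) * monProd (fun j : {j : Fin d // j ≠ i} => chartGen c i j.1) (fun j => e j.1)) ∈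
      (maximalIdeal L) ^ m := by
  classical
  obtain ⟨G, hG⟩ : ∃ G : chartRing c i,
      G = ∑ e ∈ E, chartBase c i (b e) * monProd (fun j : {j : Fin d // j ≠ i} => chartGen c i j.1) (fun j => e j.1) :=
    ⟨_, rfl⟩
  obtain ⟨Gbar, hGbar⟩ : ∃ Gbar : MvPolynomial {j : Fin d // j ≠ i} (ResidueField R),
      Gbar = ∑ e ∈ E, MvPolynomial.monomial (restrictExp i e) (residue R (b e)) := ⟨_, rfl⟩
  obtain ⟨ρ, hρ⟩ : ∃ ρ : chartRing c i →+* MvPolynomial {j : Fin d // j ≠ i} (ResidueField R), ρ = rho c i hc hqr :=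
    ⟨_, rfl⟩
  rw [← hG]
  rw [← hGbar, ← hρ] at hs'G
  rw [← hρ] at hs'
  obtain ⟨Eₙ, hEₙ⟩ : ∃ Eₙ : Ideal (chartRing c i), Eₙ = Ideal.span {chartBase c i (c i ^ n)} := ⟨_, rfl⟩
  have hci : c i ∈ maximalIdeal R := by rw [← hc]; exact Ideal.subset_span ⟨i, rfl⟩
  have hρT : ρ (chartBase c i (c i ^ n)) = 0 := by
    rw [hρ, rho_base, (IsLocalRing.residue_eq_zero_iff _).2 (Ideal.pow_mem_of_mem _ hci n (by omega)),
      MvPolynomial.C_0]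
  have hEker : Eₙ ≤ RingHom.ker ρ := by
    rw [hEₙ, Ideal.span_singleton_le_iff_mem, RingHom.mem_ker]; exact hρT
  have hle : (maximalIdeal R) ^ n ≤ Eₙ.comap (chartBase c i) := by
    rw [← Ideal.map_le_iff_le_comap, ← hc, hEₙ]
    exact map_pow_span_le (chartBase c i) c i (fun r hr => reesChartBase_mem_span_of_mem c i hr) n
  have hTn : chartBase c i (c i ^ n) ∈ 𝔴 ^ n := by
    rw [map_pow]; exact Ideal.pow_mem_pow hK𝔴 n
  obtain ⟨ψ, hψ⟩ : ∃ ψ : ResidueField R →+* chartRing c i ⧸ Eₙ,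
      ψ = (Ideal.quotientMap Eₙ (chartBase c i) hle).comp sbar := ⟨_, rfl⟩
  obtain ⟨Λ, hΛdef⟩ : ∃ Λ : MvPolynomial {j : Fin d // j ≠ i} (ResidueField R) →+* chartRing c i ⧸ Eₙ,
      Λ = MvPolynomial.eval₂Hom ψ (fun j => Ideal.Quotient.mk Eₙ (chartGen c i j.1)) := ⟨_, rfl⟩
  -- `Λ̄` is a section of `ρ̄` (checked on generators; uses the SECTION property of `s̄`)
  have hΛ : ∀ x, Ideal.Quotient.lift Eₙ ρ (fun _ hb => hEker hb) (Λ x) = x := by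
    intro x
    rw [hΛdef]
    refine section_of_generators Eₙ _ ψ _ (fun β => ?_) (fun j => ?_) x
    · obtain ⟨r, hr1, hr2⟩ := hsbar β
      rw [hψ, RingHom.comp_apply, ← hr1, Ideal.quotientMap_mk, Ideal.Quotient.lift_mk, ← hr2, hρ]
      exact rho_base c i hc hqr r
    · rw [Ideal.Quotient.lift_mk, hρ]; exact rho_gen c i hc hqr j
  -- `G` lifts `Λ̄ Ḡ` (uses ADAPTEDNESS of the coefficients)
  have hGlift : Ideal.Quotient.mk Eₙ G = Λ Gbar := by
    rw [hG, hGbar]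
    refine (map_sum (Ideal.Quotient.mk Eₙ) _ _).trans
      ((Finset.sum_congr rfl fun e he => ?_).trans (map_sum Λ _ _).symm)
    rw [hΛdef, MvPolynomial.coe_eval₂Hom, MvPolynomial.eval₂_monomial]
    refine (map_mul _ _ _).trans ?_
    congr 1
    · rw [hψ, RingHom.comp_apply, ← hb e he, Ideal.quotientMap_mk]
    · rw [Finsupp.prod_fintype _ _ (fun j => pow_zero _), monProd, map_prod]
      refine Finset.prod_congr rfl fun j _ => ?_
      rw [restrictExp_apply, map_pow]
  obtain ⟨U, hU⟩ := Ideal.Quotient.mk_surjective (I := Eₙ) (Λ s')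
  have hlift : Ideal.Quotient.mk Eₙ (U * G) = Λ (s' * Gbar) := by rw [map_mul, map_mul, hU, hGlift]
  have hmem := lift_mem_pow_sup_of_section ρ Eₙ hEker Λ hΛ (𝔴.map ρ) m hs'G hlift
  have hcm : (𝔴.map ρ).comap ρ = 𝔴 := by rw [hρ]; exact comap_map_rho c i hc hqr 𝔴 hK𝔴
  rw [hcm, hEₙ] at hmem
  have hρU : ρ U = s' := by rw [← hΛ s', ← hU, Ideal.Quotient.lift_mk]
  have hU𝔴 : U ∉ 𝔴 := fun h => hs' (by rw [← hρU]; exact Ideal.mem_map_of_mem ρ h)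
  exact map_mem_pow_of_mul_mem_pow_sup 𝔴 χ hloc hTn hmn hU𝔴 hmem

end Below

section Law

/-- **«δ-HEAVY ⟹ NEAR» at ring level (direction giving exactness of the re-location):** if EVERY layer `k ∈ [0, n)` of an
ADAPTED presentation is δ-HEAVY at `𝔮 = ρ(𝔴)` (`s_k·Ḡ_k ∈ 𝔮^{n-k}` for some `s_k ∉ 𝔮`), then the transform
`Σ_{k<n} σ(cᵢ)^k χ(G_k) + σ(cᵢ)^n χ(b_n)` IS in `𝔫_L^n` (`R` local, any `b_n`): each layer lifts GENUINELY
(`lifting_up`). [new] [folklore] -/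
theorem transform_mem_pow_of_delta_heavy {R : Type*} [CommRing R] [IsLocalRing R] {d : ℕ} (c : Fin d → R) (i : Fin d)
    (hc : Ideal.span (Set.range c) = maximalIdeal R) (hqr : IsQuasiRegular c)
    (𝔴 : Ideal (chartRing c i)) [𝔴.IsPrime] (h𝔴 : 𝔴.comap (chartBase c i) = maximalIdeal R)
    (L : Type*) [CommRing L] [IsLocalRing L] (σ : R →+* L) (χ : chartRing c i →+* L)
    (hχ : ∀ r, χ (chartBase c i r) = σ r) (hloc : @IsLocalization.AtPrime _ _ L _ χ.toAlgebra 𝔴 _)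
    {n : ℕ} (hn : 1 ≤ n) (sbar : ResidueField R →+* R ⧸ (maximalIdeal R) ^ n)
    (hsbar : ∀ β : ResidueField R, ∃ r : R, Ideal.Quotient.mk ((maximalIdeal R) ^ n) r = sbar β ∧ residue R r = β)
    (E : ℕ → Finset (Fin d → ℕ)) (b : ℕ → (Fin d → ℕ) → R)
    (hb : ∀ k e, Ideal.Quotient.mk ((maximalIdeal R) ^ n) (b k e) = sbar (residue R (b k e)))
    (hheavy : ∀ k, k < n → ∃ s ∉ 𝔴.map (rho c i hc hqr),
      s * (∑ e ∈ E k, MvPolynomial.monomial (restrictExp i e) (residue R (b k e))) ∈ (𝔴.map (rho c i hc hqr)) ^ (n - k))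
    (bn : chartRing c i) :
    ∑ k ∈ Finset.range n, σ (c i) ^ k *
      χ (∑ e ∈ E k, chartBase c i (b k e) * monProd (fun j : {j : Fin d // j ≠ i} => chartGen c i j.1) (fun j => e j.1)) +
        σ (c i) ^ n * χ bn ∈ maximalIdeal L ^ n := by
  classical
  letI alg : Algebra (chartRing c i) L := χ.toAlgebra
  haveI : IsLocalization.AtPrime L 𝔴 := hloc
  have halg : ∀ w, algebraMap (chartRing c i) L w = χ w := fun w => by rw [RingHom.algebraMap_toAlgebra]
  have hmem𝔴 : ∀ w : chartRing c i, χ w ∈ maximalIdeal L ↔ w ∈ 𝔴 := fun w => by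
    rw [← halg]; exact IsLocalization.AtPrime.to_map_mem_maximal_iff L 𝔴 w
  have hK𝔴 : chartBase c i (c i) ∈ 𝔴 := by
    rw [← Ideal.mem_comap, h𝔴, ← hc]; exact Ideal.subset_span ⟨i, rfl⟩
  have ht : σ (c i) ∈ maximalIdeal L := by rw [← hχ, hmem𝔴]; exact hK𝔴
  refine add_mem (Ideal.sum_mem _ fun k hk => ?_) ?_
  · have hkn : k < n := Finset.mem_range.mp hk
    obtain ⟨s', hs', hs'G⟩ := hheavy k hkn
    have hGk := lifting_up c i hc hqr 𝔴 hK𝔴 χ hloc hn sbar hsbar (E k) (b k) (fun e _ => hb k e)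
      (show n - k ≤ n by omega) hs' hs'G
    have h := Ideal.mul_mem_mul (Ideal.pow_mem_pow ht k) hGk
    rwa [← pow_add, show k + (n - k) = n from by omega] at h
  · exact Ideal.mul_mem_right _ _ (Ideal.pow_mem_pow ht n)

set_option maxHeartbeats 800000 in
/-- **THE δ-LAW AT A POINT, local-algebra form (all layers; direction «δ-light ⟹ not near»).**  `R` regular local with regular
system of parameters `c` (`hqr`: any proof, e.g. `isQuasiRegular_rsop_comp hd c hc id Function.injective_id`), `𝔴 ∋
cᵢ` a prime of
the Rees chart ring `R[(c)/cᵢ]` over `𝔪`, `L = R[(c)/cᵢ]_𝔴` (via `χ`); an ADAPTED presentation: layers `G_k = Σ_{e ∈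
E_k} b_{k,e} e^e`,
`k ∈ [0, n)`, whose coefficients are adapted to a ring section `s̄ : κ → R ⧸ 𝔪^n` (`mk (b k e) = s̄ (b k e)‾`).  If SOME layer
`k₀ < n` is δ-LIGHT at the prime `𝔮 = ρ(𝔴)` of `κ[T_j : j ≠ i]` below `𝔴` — `s·Ḡ_{k₀} ∉ 𝔮^{n-k₀}` for all `s ∉ 𝔮` — then the
transform `Σ_{k<n} σ(cᵢ)^k χ(G_k) + σ(cᵢ)^n χ(b_n)` is NOT in `𝔫_L^n`.  PEELING INDUCTION from layer `0`: `S_k ∈ 𝔫^{n-k}` read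
DOWN (`reading_down`) makes layer `k` heavy at `𝔮`, which lifts UP genuinely (`lifting_up`, adaptedness), so
`t·S_{k+1} ∈ 𝔫^{n-k}`
and `S_{k+1} ∈ 𝔫^{n-k-1}` (`t ∉ 𝔫²`, `L` regular: Literature `isRsopPart_chartFamily_reesChart`); at `k₀` this contradicts
lightness.  DICTIONARY: «layer `k` heavy at 𝔮 for all k» is Hironaka's `δ ≥ 1` at the point of `ℙ(Dir)` under `𝔮` for the
polyhedron of the presentation (tree `CharPolyhedronDeltaPositive.deltaGE_one_pos_iff_forall_mem`: `δ(Δ⁺) ≥ 1 ⟺` every vertex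
has modulus `≥ 1`), read prime by prime in the Rees charts; no vertex preparation is needed because adaptedness makes the chart
reading exact (`lifting_up`). [new] (Sources: CossartJannsenSaito2020, Thm 9.6; DeJong1996, 2.4; StacksProject, Tag 0BIQ.) -/
theorem delta_law_at {R : Type u} [CommRing R] [IsRegularLocalRing R] {d : ℕ} (c : Fin d → R) (i : Fin d)
    (hd : (maximalIdeal R).spanFinrank = d) (hc : Ideal.span (Set.range c) = maximalIdeal R) (hqr : IsQuasiRegular c)
    (𝔴 : Ideal (chartRing c i)) [𝔴.IsPrime] (h𝔴 : 𝔴.comap (chartBase c i) = maximalIdeal R)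
    (L : Type u) [CommRing L] [IsLocalRing L] (σ : R →+* L) (χ : chartRing c i →+* L)
    (hχ : ∀ r, χ (chartBase c i r) = σ r) (hloc : @IsLocalization.AtPrime _ _ L _ χ.toAlgebra 𝔴 _)
    {n : ℕ} (hn : 1 ≤ n) (sbar : ResidueField R →+* R ⧸ (maximalIdeal R) ^ n)
    (hsbar : ∀ β : ResidueField R, ∃ r : R, Ideal.Quotient.mk ((maximalIdeal R) ^ n) r = sbar β ∧ residue R r = β)
    (E : ℕ → Finset (Fin d → ℕ)) (b : ℕ → (Fin d → ℕ) → R)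
    (hb : ∀ k e, Ideal.Quotient.mk ((maximalIdeal R) ^ n) (b k e) = sbar (residue R (b k e)))
    (hδ : ∃ k, k < n ∧ ∀ s ∉ 𝔴.map (rho c i hc hqr),
        s * (∑ e ∈ E k, MvPolynomial.monomial (restrictExp i e) (residue R (b k e))) ∉ (𝔴.map (rho c i hc hqr)) ^ (n - k))
    (bn : chartRing c i)
    (hw : ∑ k ∈ Finset.range n, σ (c i) ^ k *
      χ (∑ e ∈ E k, chartBase c i (b k e) * monProd (fun j : {j : Fin d // j ≠ i} => chartGen c i j.1) (fun j => e j.1)) +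
        σ (c i) ^ n * χ bn ∈ maximalIdeal L ^ n) : False := by
  classical
  obtain ⟨G, hG⟩ : ∃ G : ℕ → chartRing c i, ∀ k, G k =
      ∑ e ∈ E k, chartBase c i (b k e) * monProd (fun j : {j : Fin d // j ≠ i} => chartGen c i j.1) (fun j => e j.1) :=
    ⟨_, fun k => rfl⟩
  obtain ⟨Gbar, hGbar⟩ : ∃ Gbar : ℕ → MvPolynomial {j : Fin d // j ≠ i} (ResidueField R), ∀ k, Gbar k =
      ∑ e ∈ E k, MvPolynomial.monomial (restrictExp i e) (residue R (b k e)) := ⟨_, fun k => rfl⟩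
  have hsum : ∑ k ∈ Finset.range n, σ (c i) ^ k *
      χ (∑ e ∈ E k, chartBase c i (b k e) * monProd (fun j : {j : Fin d // j ≠ i} => chartGen c i j.1) (fun j => e j.1)) =
        ∑ k ∈ Finset.range n, σ (c i) ^ k * χ (G k) := Finset.sum_congr rfl fun k _ => by rw [hG k]
  rw [hsum] at hw
  letI alg : Algebra (chartRing c i) L := χ.toAlgebra
  haveI : IsLocalization.AtPrime L 𝔴 := hloc
  have halg : ∀ w, algebraMap (chartRing c i) L w = χ w := fun w => by rw [RingHom.algebraMap_toAlgebra]
  have hK𝔴 : chartBase c i (c i) ∈ 𝔴 := by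
    rw [← Ideal.mem_comap, h𝔴, ← hc]; exact Ideal.subset_span ⟨i, rfl⟩
  -- `L` is regular and `t ∉ 𝔫²` (Literature `isRsopPart_chartFamily_reesChart`, DeJong1996 2.4)
  have hz : Ideal.span (Set.range (Fin.append c (Fin.elim0 : Fin 0 → R))) = maximalIdeal R := by
    have hr : Set.range (Fin.append c (Fin.elim0 : Fin 0 → R)) = Set.range c := by
      rw [Fin.append_elim0]
      ext x
      constructor
      · rintro ⟨k, rfl⟩; exact ⟨_, rfl⟩
      · rintro ⟨k, rfl⟩; exact ⟨Fin.cast (Nat.add_zero d).symm k, rfl⟩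
    rw [hr]; exact hc
  have hrs := isRsopPart_chartFamily_reesChart c i (Fin.elim0 : Fin 0 → R) hz hd 𝔴 h𝔴 L (a := 0)
    (fun k => Fin.elim0 k) (Function.injective_of_subsingleton _) fun k => Fin.elim0 k
  haveI : IsRegularLocalRing L := hrs.isRegularLocalRing
  have ht2 : σ (c i) ∉ maximalIdeal L ^ 2 := by
    have h1 := hrs.not_mem_sq 0
    have h2 : chartFamily c i (Fin.elim0 : Fin 0 → R) L (chartBase c i) (chartGen c i) (fun k => Fin.elim0 k) 0 =
        σ (c i) := by
      rw [chartFamily, Fin.cons_zero, halg, hχ]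
    rwa [h2] at h1
  -- the partial tails `S_k = Σ_{j ≥ k} t^{j-k} χ(G_j) + t^{n-k} χ(b_n)` and the recursion `S_k = χ(G_k) + t S_{k+1}`
  obtain ⟨S, hS⟩ : ∃ S : ℕ → L, ∀ k, S k =
      ∑ j ∈ Finset.Ico k n, σ (c i) ^ (j - k) * χ (G j) + σ (c i) ^ (n - k) * χ bn := ⟨_, fun k => rfl⟩
  have hrec : ∀ k, k < n → S k = χ (G k) + σ (c i) * S (k + 1) := by
    intro k hk
    have h1 : ∑ j ∈ Finset.Ico (k + 1) n, σ (c i) ^ (j - k) * χ (G j) =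
        σ (c i) * ∑ j ∈ Finset.Ico (k + 1) n, σ (c i) ^ (j - (k + 1)) * χ (G j) := by
      rw [Finset.mul_sum]
      refine Finset.sum_congr rfl fun j hj => ?_
      have hj := (Finset.mem_Ico.mp hj).1
      rw [← mul_assoc, ← pow_succ', show j - (k + 1) + 1 = j - k from by omega]
    have h2 : σ (c i) ^ (n - k) = σ (c i) * σ (c i) ^ (n - (k + 1)) := by
      rw [← pow_succ', show n - (k + 1) + 1 = n - k from by omega]
    rw [hS k, hS (k + 1), Finset.sum_eq_sum_Ico_succ_bot hk, Nat.sub_self, pow_zero, one_mul, h1, h2]; ring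
  have hx0 : S 0 ∈ maximalIdeal L ^ (n - 0) := by
    have h1 : S 0 = ∑ k ∈ Finset.range n, σ (c i) ^ k * χ (G k) + σ (c i) ^ n * χ bn := by
      rw [hS 0, Finset.range_eq_Ico]
      simp only [Nat.sub_zero]
    rw [h1, Nat.sub_zero]; exact hw
  -- the prime `𝔮 = ρ(𝔴)` below, on `κ[T_j : j ≠ i]`
  obtain ⟨𝔮, h𝔮⟩ : ∃ 𝔮 : Ideal (MvPolynomial {j : Fin d // j ≠ i} (ResidueField R)), 𝔮 = 𝔴.map (rho c i hc hqr) :=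
    ⟨_, rfl⟩
  haveI h𝔮p : 𝔮.IsPrime := by rw [h𝔮]; exact map_rho_isPrime c i hc hqr 𝔴 hK𝔴
  -- (a) READING DOWN: `S_k ∈ 𝔫^{n-k}` forces layer `k` to be δ-heavy at `𝔮`
  have hread : ∀ k, k < n → S k ∈ maximalIdeal L ^ (n - k) → ∃ s' ∉ 𝔮, s' * Gbar k ∈ 𝔮 ^ (n - k) := by
    intro k hk hSk
    obtain ⟨s, hs, hsG⟩ := exists_mul_mem_sup_of_localization (S := L) 𝔴 (G k) (chartBase c i (c i)) (S (k + 1))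
      (S k) (by rw [halg, halg, hχ, hrec k hk]; ring) hSk
    rw [hG k] at hsG
    have h := reading_down c i hc hqr 𝔴 hK𝔴 (E k) (b k) hs hsG
    rwa [← hGbar k, ← h𝔮] at h
  -- (b) LIFTING UP (LEMMA A + LEMMA B via `lifting_up`): a δ-heavy layer `k` at `𝔮` gives `χ(G_k) ∈ 𝔫^{n-k}` GENUINELY
  have hliftup : ∀ k, k < n → (∃ s' ∉ 𝔮, s' * Gbar k ∈ 𝔮 ^ (n - k)) → χ (G k) ∈ maximalIdeal L ^ (n - k) := by
    rintro k hk ⟨s', hs', hs'G⟩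
    rw [h𝔮, hGbar k] at hs'G
    rw [h𝔮] at hs'
    rw [hG k]
    exact lifting_up c i hc hqr 𝔴 hK𝔴 χ hloc hn sbar hsbar (E k) (b k) (fun e _ => hb k e)
      (show n - k ≤ n by omega) hs' hs'G
  -- THE PEELING INDUCTION from layer `0` up to the δ-light layer `k₀`
  obtain ⟨k₀, hk₀n, hlight₀⟩ := hδ
  have hpeel : ∀ k, k ≤ k₀ → S k ∈ maximalIdeal L ^ (n - k) := by
    intro k hkk₀
    induction k with
    | zero => exact hx0
    | succ k ih =>
      have hk : k < n := by omega
      have hSk := ih (by omega)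
      have hGk : χ (G k) ∈ maximalIdeal L ^ (n - k) := hliftup k hk (hread k hk hSk)
      have h1 : σ (c i) * S (k + 1) ∈ maximalIdeal L ^ (n - k) := by
        have h2 := sub_mem hSk hGk
        rwa [hrec k hk, add_sub_cancel_left] at h2
      have h3 := mem_pow_pred_of_mul_mem_pow ht2 h1
      rwa [show n - k - 1 = n - (k + 1) from by omega] at h3
  obtain ⟨s', hs', hs'G⟩ := hread k₀ hk₀n (hpeel k₀ le_rfl)
  rw [h𝔮, hGbar k₀] at hs'G
  rw [h𝔮] at hs'
  exact hlight₀ s' hs' hs'G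

/-- **THE NEAR-POINT CRITERION FOR ONE ELEMENT (ring level, both directions):** for an adapted presentation the
transform lies in
`𝔫_L^n` **iff** every layer `k ∈ [0, n)` is δ-heavy at `𝔮 = ρ(𝔴)`. [new] [folklore] -/
theorem transform_mem_pow_iff_delta_heavy {R : Type u} [CommRing R] [IsRegularLocalRing R] {d : ℕ} (c : Fin d → R)
    (i : Fin d) (hd : (maximalIdeal R).spanFinrank = d) (hc : Ideal.span (Set.range c) = maximalIdeal R)
    (hqr : IsQuasiRegular c)
    (𝔴 : Ideal (chartRing c i)) [𝔴.IsPrime] (h𝔴 : 𝔴.comap (chartBase c i) = maximalIdeal R)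
    (L : Type u) [CommRing L] [IsLocalRing L] (σ : R →+* L) (χ : chartRing c i →+* L)
    (hχ : ∀ r, χ (chartBase c i r) = σ r) (hloc : @IsLocalization.AtPrime _ _ L _ χ.toAlgebra 𝔴 _)
    {n : ℕ} (hn : 1 ≤ n) (sbar : ResidueField R →+* R ⧸ (maximalIdeal R) ^ n)
    (hsbar : ∀ β : ResidueField R, ∃ r : R, Ideal.Quotient.mk ((maximalIdeal R) ^ n) r = sbar β ∧ residue R r = β)
    (E : ℕ → Finset (Fin d → ℕ)) (b : ℕ → (Fin d → ℕ) → R)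
    (hb : ∀ k e, Ideal.Quotient.mk ((maximalIdeal R) ^ n) (b k e) = sbar (residue R (b k e))) (bn : chartRing c i) :
    ∑ k ∈ Finset.range n, σ (c i) ^ k *
      χ (∑ e ∈ E k, chartBase c i (b k e) * monProd (fun j : {j : Fin d // j ≠ i} => chartGen c i j.1) (fun j => e j.1)) +
        σ (c i) ^ n * χ bn ∈ maximalIdeal L ^ n ↔
      ∀ k, k < n → ∃ s ∉ 𝔴.map (rho c i hc hqr),
        s * (∑ e ∈ E k, MvPolynomial.monomial (restrictExp i e) (residue R (b k e))) ∈
          (𝔴.map (rho c i hc hqr)) ^ (n - k) := by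
  classical
  constructor
  · intro hw
    by_contra hne
    push Not at hne
    obtain ⟨k, hkn, hlight⟩ := hne
    exact delta_law_at c i hd hc hqr 𝔴 h𝔴 L σ χ hχ hloc hn sbar hsbar E b hb ⟨k, hkn, hlight⟩ bn hw
  · intro hheavy
    exact transform_mem_pow_of_delta_heavy c i hc hqr 𝔴 h𝔴 L σ χ hχ hloc hn sbar hsbar E b hb hheavy bn

end Law

end Summit.ResolutionOfSingularities.ResolutionOfSingularities.Theorems.DeltaCutClasses
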